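import Literature.AnabelianGeometry.SemiGraphs.Commensurability

/-!
# [SemiAnbd] Remark 2.7.2 from Corollary 2.7 (i) (proof-only companion of `Commensurability.lean`)

Mochizuki, *Semi-graphs of anabelioids*, Publ. RIMS **42** (2006) 221–322, §2, author's manuscript
p. 30, Remark 2.7.2 [cite: MochizukiSemiAnbd2006, Rem. 2.7.2 p.30]: "Thus, (the proof of)
Corollary 2.7, (i), implies that if `J ⊆ Π_𝒢` is any [not necessarily closed!] subgroup such that
`Π_v ⊆ J`, then `C_J(Π_v) ⊆ C_{Π_𝒢}(Π_v) = Π_v` — i.e., `Π_v` is commensurably terminal in `J`."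

This file kernel-checks exactly the printed implication: the named fact `remark_2_7_2` follows from
the named fact `corollary_2_7_i` (`remark_2_7_2_of_corollary_2_7_i`), by the elementary
group-theoretic observation that commensurable terminality of `K ⊆ G` descends to every intermediate
subgroup `K ⊆ J ⊆ G` (the commensurator in `J` is the commensurator in `G` intersected with `J`,
because relative indices are unchanged under restriction to `J`).  Corollary 2.7 (i) itself (the deep
input: Proposition 2.6 + quasi-coherence) is NOT proved here; when `corollary_2_7_i_holds` lands,
`remark_2_7_2_holds` is the one-line composite.

No new definitions; statements untouched (discharge companion, abc-iut cell rule).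
-/

namespace Literature.AnabelianGeometry.SemiGraphs

open Literature.AnabelianGeometry.AbsoluteAnabelian
open scoped Pointwise

universe v₁ u₁ u

section GroupTheory

variable {G : Type*} [Group G]

/-- Conjugating `K ∩ J` (viewed inside `J`) by an element of `J` is conjugating `K` in `G` and then
restricting to `J`. [folklore] -/
private theorem conjAct_smul_subgroupOf {K J : Subgroup G} (hKJ : K ≤ J) (j : J) :
    ConjAct.toConjAct j • K.subgroupOf J = (ConjAct.toConjAct (j : G) • K).subgroupOf J := by
  ext x
  rw [Subgroup.mem_smul_pointwise_iff_exists, Subgroup.mem_subgroupOf,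
    Subgroup.mem_smul_pointwise_iff_exists]
  constructor
  · rintro ⟨s, hs, rfl⟩
    refine ⟨(s : G), Subgroup.mem_subgroupOf.mp hs, ?_⟩
    rw [ConjAct.smul_def, ConjAct.ofConjAct_toConjAct, ConjAct.smul_def,
      ConjAct.ofConjAct_toConjAct]
    simp
  · rintro ⟨s, hs, hsx⟩
    rw [ConjAct.smul_def, ConjAct.ofConjAct_toConjAct] at hsx
    have hsJ : s ∈ J := hKJ hs
    refine ⟨⟨s, hsJ⟩, Subgroup.mem_subgroupOf.mpr hs, ?_⟩
    rw [ConjAct.smul_def, ConjAct.ofConjAct_toConjAct]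
    exact Subtype.ext (by simpa using hsx)

/-- A subgroup is contained in its own commensurator. [folklore] -/
private theorem le_commensurator (K : Subgroup G) :
    K ≤ Subgroup.Commensurable.commensurator K := by
  intro k hk
  rw [Subgroup.Commensurable.commensurator_mem_iff]
  have hKK : ConjAct.toConjAct k • K = K := by
    ext x
    rw [Subgroup.mem_smul_pointwise_iff_exists]
    constructor
    · rintro ⟨s, hs, rfl⟩
      rw [ConjAct.smul_def, ConjAct.ofConjAct_toConjAct]
      exact K.mul_mem (K.mul_mem hk hs) (K.inv_mem hk)
    · intro hx
      refine ⟨k⁻¹ * x * k, K.mul_mem (K.mul_mem (K.inv_mem hk) hx) hk, ?_⟩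
      rw [ConjAct.smul_def, ConjAct.ofConjAct_toConjAct]
      group
  rw [hKK]

/-- A conjugate of `K ⊆ J` by an element of `J` stays inside `J`. [folklore] -/
private theorem conjAct_smul_le {K J : Subgroup G} (hKJ : K ≤ J) {j : G} (hj : j ∈ J) :
    ConjAct.toConjAct j • K ≤ J := by
  intro x hx
  rw [Subgroup.mem_smul_pointwise_iff_exists] at hx
  obtain ⟨s, hs, rfl⟩ := hx
  rw [ConjAct.smul_def, ConjAct.ofConjAct_toConjAct]
  exact J.mul_mem (J.mul_mem hj (hKJ hs)) (J.inv_mem hj)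

/-- Commensurable terminality descends to intermediate subgroups: if `C_G(K) = K` and `K ⊆ J ⊆ G`,
then `C_J(K) = K` — the group-theoretic content of [SemiAnbd] Remark 2.7.2 ("`C_J(Π_v) ⊆
C_{Π_𝒢}(Π_v) = Π_v`"). [cite: MochizukiSemiAnbd2006, Rem. 2.7.2 p.30] -/
theorem isCommensurablyTerminal_subgroupOf {K J : Subgroup G} (h : IsCommensurablyTerminal K)
    (hKJ : K ≤ J) : IsCommensurablyTerminal (K.subgroupOf J) := by
  refine ⟨le_antisymm ?_ (le_commensurator _)⟩
  intro j hj
  rw [Subgroup.Commensurable.commensurator_mem_iff, conjAct_smul_subgroupOf hKJ] at hj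
  have h1 : Subgroup.Commensurable (ConjAct.toConjAct (j : G) • K) K := by
    unfold Subgroup.Commensurable at hj ⊢
    rwa [Subgroup.relIndex_subgroupOf hKJ, Subgroup.relIndex_subgroupOf (conjAct_smul_le hKJ j.2)]
      at hj
  have h2 : (j : G) ∈ Subgroup.Commensurable.commensurator K :=
    (Subgroup.Commensurable.commensurator_mem_iff K j).mpr h1
  rw [h.commensurator_eq] at h2
  exact Subgroup.mem_subgroupOf.mpr h2

end GroupTheory

namespace SemiGraphOfAnabelioids

/-- **[SemiAnbd] Remark 2.7.2, as printed: "Corollary 2.7, (i), implies that if `J ⊆ Π_𝒢` is any [not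
necessarily closed!] subgroup such that `Π_v ⊆ J`, then `C_J(Π_v) ⊆ C_{Π_𝒢}(Π_v) = Π_v` — i.e., `Π_v`
is commensurably terminal in `J`."**  The named fact `remark_2_7_2` follows from the named fact
`corollary_2_7_i` (its second clause, `C_{Π_𝒢}(Π_v) = Π_v` for `v` elevated) by
`isCommensurablyTerminal_subgroupOf`. [cite: MochizukiSemiAnbd2006, Rem. 2.7.2 p.30] -/
theorem remark_2_7_2_of_corollary_2_7_i (h : corollary_2_7_i.{v₁, u₁, u}) :
    remark_2_7_2.{v₁, u₁, u} := by
  intro 𝒢 hconn hgraph hqc v hv F _ J hJ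
  exact isCommensurablyTerminal_subgroupOf ((h 𝒢 hconn hgraph hqc).2 v hv F) hJ

end SemiGraphOfAnabelioids

end Literature.AnabelianGeometry.SemiGraphs
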